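import Summits.HodgeConjecture.HodgeConjecture.Theorems.Ring2WeilCoverageCMFieldCarrierGalois
import HarnessLib

/-!
# Ring 2 — Weil-type family-coverage census, CM-field rows (X-M): the census carriers II — the four BIQUADRATIC
# fields `ℚ(ζ₈) = ℚ(i,√2)`, `ℚ(ζ₁₂) = ℚ(i,√3)`, `ℚ(√-3,√5)`, `ℚ(i,√5)` are Galois with an explicit imaginary
# quadratic subfield, and on EVERY row `W8.E.δ` of their tables a CM eightfold with HC in the kernel

HONEST FRAMING: research route conditional on HC_CM; not a corollary; Q11.4-sentence-2 already refuted in dim ≥ 3.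

Cell `pub-hodge-ring2`, seat `ring2-b03` (gen 56), census `WEIL-FAMILY-COVERAGE.md` «## b03», open cell (xi′) of b03.20,
companion of part X-L (`Ring2WeilCoverageCMFieldCarrierInstances`: the cyclic and non-Galois carriers); both rest on part X-K only. For each
biquadratic census carrier `R = S² + pS + q` — `E = cmField R = ℚ(η)`, `η⁴ + pη² + q = 0` — two elements of `E`
checked by `linear_combination` against `η⁴ + pη² + q = 0`: the twist `η'` with `η'² + η² + p = 0` (so `E/ℚ` is
Galois, part X-K `isGalois_of_sq_add`) and a square root `i` of `-c`, `c ∈ {1, 3}` (so `ℚ(√-c) ⊂ E` and the CM type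
induced from `ℚ(√-c)` gives the Hazama/Pohlmann member, part X-K `carrier_exists_cmEightfold_hodgeConjectureFor_of_sqrt`):

| field `E` | `(p,q)` | `η'` | `c` | `i`, `i² = -c` |
|---|---|---|---|---|
| `ℚ(ζ₈) = ℚ(i,√2)` (`η = i(1+√2)`) | `(6,1)` | `-η³ - 6η = η⁻¹` | `1` | `-(η³ + 5η)/2` |
| `ℚ(ζ₁₂) = ℚ(i,√3)` (`η = i(1+√3)`) | `(8,4)` | `-(η³ + 8η)/2 = 2η⁻¹` | `1` | `-(η³ + 6η)/4` |
| `ℚ(√-3,√5)` (`η = √-3(1+√5)/2`) | `(9,9)` | `-(η³ + 9η)/3 = 3η⁻¹` | `3` | `-(η³ + 6η)/3` |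
| `ℚ(i,√5)` (`η = i(1+√5)/2`) | `(3,1)` | `-η³ - 3η = η⁻¹` | `1` | `-η³ - 2η` |

§0 `carrier_exists_cmMember_hodgeConjectureFor_of_sqrt` (every `E`-rank `2n`: rows `W_{4n}.E.δ`, `g = 4n = 4, 8, 12, …`, from
X-J/X-C). Per field: `…_fact_cmPolyQ`, `…_twist_sq`, `…_sqrtNegOne_sq` / `…_sqrtNegThree_sq`, `…_isGalois`,
`…_carrier_allRanks_hodgeConjectureFor` (every `n ≥ 1`), and
**`…_carrier_rows_hodgeConjectureFor`: for EVERY `δ ∈ cmNormResidueGroup R` (the index type of `zeta8_table`,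
`zeta12_table`, `sqrtNeg3Sqrt5_table`, `sqrtNeg1Sqrt5_table` and parts I/J of the all-primes series) a CM eightfold
(`B⁴`, `B ~ C₁²`, `C₁` an elliptic curve with CM by `ℚ(√-c)`) with a Weil-type `(2,2;2,2)` datum relative to `E`, a
Rosati-compatible polarization class of discriminant `δ`, `HodgeConjectureFor A.dim A.X` (kernel: Hazama / Pohlmann,
unconditional) and `W_E(A) ⊗ ℂ ⊂ H⁴` algebraic.**

THEOREMS ONLY: no `def`, no named fact, no `sorry`; `HC_CM` does not occur. HONEST COLUMN: named CM members only;
nothing at the general member of any row (crux stmt-1076); the sign of `δ` is not recorded by `IsPolarizationClass`.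

## References
* [Deligne1982HodgeCycles] P. Deligne (notes by J. S. Milne), LNM 900 (1982), §4 and §5 (c).
* [Gordon1999HodgeAVSurvey] B. Gordon, Appendix B to Lewis, *A survey of the Hodge conjecture* (1999), Thm. 6.4
  (Hazama: non-simple CM abelian varieties). [Kubota1965] T. Kubota, Trans. AMS 118 (1965), §2.
* [Shimura1998] G. Shimura, *Abelian Varieties with Complex Multiplication and Modular Functions* (1998), §8 Ex. 8.4 (2).
-/

noncomputable section

set_option linter.dupNamespace false

namespace Summit.HodgeConjecture.HodgeConjecture.Ring2.WeilCoverageCM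

open CategoryTheory CategoryTheory.Limits Polynomial NumberField
open Literature.AlgebraicGeometry Literature.AlgebraicGeometry.Motives Literature.AlgebraicGeometry.HodgeTheory
open Literature.AlgebraicGeometry.ComplexMultiplication Literature.AlgebraicGeometry.Deligne1982
open Literature.AlgebraicGeometry.Milne1999
open Summit.HodgeConjecture.HodgeConjecture.Ring2.Hypotheses (RosatiCompatible)

/-! ## §0 All `E`-ranks `2p` on a carrier containing `ℚ(√-c)` (rows `W_{4p}.E.δ`, `g = 4p = 4, 8, 12, …`) -/

section AllRanks

variable {p q : ℤ} (R : Polynomial ℤ) (hR : R = X ^ 2 + C p * X + C q) [Fact (Irreducible (cmPolyQ R))]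
  [Fact (Irreducible (realPolyQ R))]
include hR

/-- **X-C on the carrier, fields containing `ℚ(√-c)`, EVERY `E`-rank `2n`:** for `R = S² + pS + q` (roots real negative),
`η' ∈ E` with `η'² + η² + p = 0` (so `E/ℚ` is Galois), `c > 0` and `i ∈ E` with `i² + c = 0`, every `n ≥ 1` and EVERY
`δ ∈ cmNormResidueGroup R`: a CM member (`B^{2n}`, `B ~ C₁²` of the type induced from `ℚ(√-c)`) with a Weil-type datum
of `E`-rank `2n`, a Rosati-compatible polarization class of discriminant `δ`, the Hodge conjecture (kernel: Hazama /
Pohlmann) and `W_E ⊗ ℂ` algebraic (`g = 4n`; the `g = 12` index rows of census b03.8 included).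
[cite: Gordon1999HodgeAVSurvey, Thm. 6.4] [cite: Deligne1982HodgeCycles, §5 (c) pp. 38–39] -/
theorem carrier_exists_cmMember_hodgeConjectureFor_of_sqrt
    (hroots : ∀ s : ℂ, Polynomial.eval₂ (Int.castRingHom ℂ) s R = 0 → s.im = 0 ∧ s.re < 0)
    (t' : cmField R) (h1 : t' ^ 2 + cmRoot R ^ 2 + (p : cmField R) = 0)
    {c : ℤ} (hc : 0 < c) (i : cmField R) (hi : i ^ 2 + (c : cmField R) = 0) {n : ℕ} (hn : 0 < n)
    (δ : cmNormResidueGroup R) :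
    ∃ (A : AbelianVariety ℂ) (η : A ⟶ A) (h : complexBetti A.X 2),
      IsOfCMType A ∧ IsWeilTypeCM A η R 2 n ∧ IsPolarizationClass A.dim A.X h ∧ RosatiCompatible A η h ∧
      HasWeilDiscriminantCM A η R 2 n h δ ∧ HodgeConjectureFor A.dim A.X ∧
      weilClassesField A η (R.comp (X ^ 2)) (2 * n) ≤ algebraicClasses A.X n := by
  haveI : IsCMField (cmField R) := isCMField_cmField hroots
  haveI : IsGalois ℚ (cmField R) := isGalois_of_sq_add R hR t' h1
  haveI := fact_irreducible_cmPolyQ_linear c hc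
  haveI := fact_irreducible_realPolyQ_linear c
  haveI : IsCMField (cmField (X + C c)) := isCMField_cmField_linear c hc
  obtain ⟨ψ, -⟩ := exists_ringHom_cmField_linear c hc i hi
  letI : Algebra (cmField (X + C c)) (cmField R) := ψ.toAlgebra
  obtain ⟨hRm, hRdeg⟩ := monic_and_natDegree_of_quadratic R hR
  obtain ⟨b₀, -, hb₀, hsep, he, hR', haev, hdegQ⟩ := carrier_presentation R hRm hRdeg hroots
  exact exists_cmMember_hodgeConjectureFor_of_quadratic_subfield (cmField R) (K₁ := cmField (X + C c))
    (finrank_cmField_linear c hc) (by omega) hb₀ hsep he hRm hRdeg hR' Fact.out hroots haev hdegQ hn δ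

end AllRanks

/-! ## §1 `ℚ(ζ₈) = ℚ(i,√2)`: `R = S² + 6S + 1` (`η = i(1+√2)`), biquadratic, `i = -(η³ + 5η)/2` -/

section Zeta8

variable {R : Polynomial ℤ} (hR : R = X ^ 2 + C 6 * X + C 1)
include hR

/-- The `Fact` for `E = ℚ(ζ₈) = ℚ[T]/(T⁴ + 6T² + 1)` (discriminant `32 = 2·4²`). [folklore] -/
theorem zeta8_fact_cmPolyQ : Fact (Irreducible (cmPolyQ R)) :=
  fact_irreducible_cmPolyQ_of_pos hR (by norm_num) (by norm_num)
    (not_sq_of_eq_prime_mul_sq (ℓ := 2) Nat.prime_two (m := 4) (by norm_num) (by norm_num))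

/-- In `ℚ(ζ₈)`: `η' = -η³ - 6η = η⁻¹` satisfies `η'² + η² + 6 = 0`. [folklore] -/
theorem zeta8_twist_sq [Fact (Irreducible (cmPolyQ R))] :
    (-cmRoot R ^ 3 - 6 * cmRoot R) ^ 2 + cmRoot R ^ 2 + ((6 : ℤ) : cmField R) = 0 := by
  have ht := cmRoot_quartic R hR
  push_cast at ht ⊢
  linear_combination (cmRoot R ^ 2 + 6) * ht

/-- In `ℚ(ζ₈)`: `i = -(η³ + 5η)/2` satisfies `i² + 1 = 0`. [folklore] -/
theorem zeta8_sqrtNegOne_sq [Fact (Irreducible (cmPolyQ R))] :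
    (-(cmRoot R ^ 3 + 5 * cmRoot R) / 2) ^ 2 + ((1 : ℤ) : cmField R) = 0 := by
  have ht := cmRoot_quartic R hR
  push_cast at ht ⊢
  linear_combination (cmRoot R ^ 2 / 4 + 1) * ht

/-- **`ℚ(ζ₈)/ℚ` is Galois.** [folklore] -/
theorem zeta8_isGalois [Fact (Irreducible (cmPolyQ R))] : IsGalois ℚ (cmField R) :=
  isGalois_of_sq_add R hR _ (zeta8_twist_sq hR)

/-- **The rows `W8.ℚ(ζ₈).δ`: on EVERY row a CM eightfold with HC in the kernel** (`B⁴`, `B ~ C₁²`, `C₁` an elliptic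
curve with CM by `ℚ(i)`; index type of `zeta8_table`). [cite: Gordon1999HodgeAVSurvey, Thm. 6.4]
[cite: Deligne1982HodgeCycles, §5 (c) pp. 38–39] -/
theorem zeta8_carrier_rows_hodgeConjectureFor [Fact (Irreducible (realPolyQ R))] (δ : cmNormResidueGroup R) :
    ∃ (A : AbelianVariety ℂ) (η : A ⟶ A) (h : complexBetti A.X 2),
      A.dim = 8 ∧ IsOfCMType A ∧ IsWeilTypeCM A η R 2 2 ∧ IsPolarizationClass A.dim A.X h ∧ RosatiCompatible A η h ∧
      HasWeilDiscriminantCM A η R 2 2 h δ ∧ HodgeConjectureFor A.dim A.X ∧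
      weilClassesField A η (R.comp (X ^ 2)) (2 * 2) ≤ algebraicClasses A.X 2 := by
  haveI := zeta8_fact_cmPolyQ hR
  exact carrier_exists_cmEightfold_hodgeConjectureFor_of_sqrt R hR
    (roots_real_neg_of_quadratic hR (by norm_num) (by norm_num) (by norm_num)) _ (zeta8_twist_sq hR)
    one_pos _ (zeta8_sqrtNegOne_sq hR) δ

/-- **All ranks: rows `W_{4n}.E.δ`, every `n ≥ 1` (`g = 4, 8, 12, …`), every `δ`** — a CM member of induced type
(from `ℚ(i)`) with Weil type of `E`-rank `2n`, polarization class of discriminant `δ`, HC in the kernel, `W_E ⊗ ℂ`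
algebraic. [cite: Gordon1999HodgeAVSurvey, Thm. 6.4] [cite: Deligne1982HodgeCycles, §5 (c) pp. 38–39] -/
theorem zeta8_carrier_allRanks_hodgeConjectureFor [Fact (Irreducible (realPolyQ R))] {n : ℕ} (hn : 0 < n)
    (δ : cmNormResidueGroup R) :
    ∃ (A : AbelianVariety ℂ) (η : A ⟶ A) (h : complexBetti A.X 2),
      IsOfCMType A ∧ IsWeilTypeCM A η R 2 n ∧ IsPolarizationClass A.dim A.X h ∧ RosatiCompatible A η h ∧
      HasWeilDiscriminantCM A η R 2 n h δ ∧ HodgeConjectureFor A.dim A.X ∧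
      weilClassesField A η (R.comp (X ^ 2)) (2 * n) ≤ algebraicClasses A.X n := by
  haveI := zeta8_fact_cmPolyQ hR
  exact carrier_exists_cmMember_hodgeConjectureFor_of_sqrt R hR
    (roots_real_neg_of_quadratic hR (by norm_num) (by norm_num) (by norm_num)) _ (zeta8_twist_sq hR)
    one_pos _ (zeta8_sqrtNegOne_sq hR) hn δ

end Zeta8

/-! ## §2 `ℚ(ζ₁₂) = ℚ(i,√3)`: `R = S² + 8S + 4` (`η = i(1+√3)`), biquadratic, `i = -(η³ + 6η)/4` -/

section Zeta12

variable {R : Polynomial ℤ} (hR : R = X ^ 2 + C 8 * X + C 4)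
include hR

/-- The `Fact` for `E = ℚ(ζ₁₂) = ℚ[T]/(T⁴ + 8T² + 4)` (discriminant `48 = 3·4²`). [folklore] -/
theorem zeta12_fact_cmPolyQ : Fact (Irreducible (cmPolyQ R)) :=
  fact_irreducible_cmPolyQ_of_pos hR (by norm_num) (by norm_num)
    (not_sq_of_eq_prime_mul_sq (ℓ := 3) Nat.prime_three (m := 4) (by norm_num) (by norm_num))

/-- In `ℚ(ζ₁₂)`: `η' = -(η³ + 8η)/2 = 2η⁻¹` satisfies `η'² + η² + 8 = 0`. [folklore] -/
theorem zeta12_twist_sq [Fact (Irreducible (cmPolyQ R))] :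
    (-(cmRoot R ^ 3 + 8 * cmRoot R) / 2) ^ 2 + cmRoot R ^ 2 + ((8 : ℤ) : cmField R) = 0 := by
  have ht := cmRoot_quartic R hR
  push_cast at ht ⊢
  linear_combination (cmRoot R ^ 2 / 4 + 2) * ht

/-- In `ℚ(ζ₁₂)`: `i = -(η³ + 6η)/4` satisfies `i² + 1 = 0`. [folklore] -/
theorem zeta12_sqrtNegOne_sq [Fact (Irreducible (cmPolyQ R))] :
    (-(cmRoot R ^ 3 + 6 * cmRoot R) / 4) ^ 2 + ((1 : ℤ) : cmField R) = 0 := by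
  have ht := cmRoot_quartic R hR
  push_cast at ht ⊢
  linear_combination (cmRoot R ^ 2 / 16 + 1 / 4) * ht

/-- **`ℚ(ζ₁₂)/ℚ` is Galois.** [folklore] -/
theorem zeta12_isGalois [Fact (Irreducible (cmPolyQ R))] : IsGalois ℚ (cmField R) :=
  isGalois_of_sq_add R hR _ (zeta12_twist_sq hR)

/-- **The rows `W8.ℚ(ζ₁₂).δ`: on EVERY row a CM eightfold with HC in the kernel** (`B⁴`, `B ~ C₁²`, `C₁` with CM by
`ℚ(i)`; index type of `zeta12_table`). [cite: Gordon1999HodgeAVSurvey, Thm. 6.4]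
[cite: Deligne1982HodgeCycles, §5 (c) pp. 38–39] -/
theorem zeta12_carrier_rows_hodgeConjectureFor [Fact (Irreducible (realPolyQ R))] (δ : cmNormResidueGroup R) :
    ∃ (A : AbelianVariety ℂ) (η : A ⟶ A) (h : complexBetti A.X 2),
      A.dim = 8 ∧ IsOfCMType A ∧ IsWeilTypeCM A η R 2 2 ∧ IsPolarizationClass A.dim A.X h ∧ RosatiCompatible A η h ∧
      HasWeilDiscriminantCM A η R 2 2 h δ ∧ HodgeConjectureFor A.dim A.X ∧
      weilClassesField A η (R.comp (X ^ 2)) (2 * 2) ≤ algebraicClasses A.X 2 := by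
  haveI := zeta12_fact_cmPolyQ hR
  exact carrier_exists_cmEightfold_hodgeConjectureFor_of_sqrt R hR
    (roots_real_neg_of_quadratic hR (by norm_num) (by norm_num) (by norm_num)) _ (zeta12_twist_sq hR)
    one_pos _ (zeta12_sqrtNegOne_sq hR) δ

/-- **All ranks: rows `W_{4n}.E.δ`, every `n ≥ 1` (`g = 4, 8, 12, …`), every `δ`** — a CM member of induced type
(from `ℚ(i)`) with Weil type of `E`-rank `2n`, polarization class of discriminant `δ`, HC in the kernel, `W_E ⊗ ℂ`
algebraic. [cite: Gordon1999HodgeAVSurvey, Thm. 6.4] [cite: Deligne1982HodgeCycles, §5 (c) pp. 38–39] -/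
theorem zeta12_carrier_allRanks_hodgeConjectureFor [Fact (Irreducible (realPolyQ R))] {n : ℕ} (hn : 0 < n)
    (δ : cmNormResidueGroup R) :
    ∃ (A : AbelianVariety ℂ) (η : A ⟶ A) (h : complexBetti A.X 2),
      IsOfCMType A ∧ IsWeilTypeCM A η R 2 n ∧ IsPolarizationClass A.dim A.X h ∧ RosatiCompatible A η h ∧
      HasWeilDiscriminantCM A η R 2 n h δ ∧ HodgeConjectureFor A.dim A.X ∧
      weilClassesField A η (R.comp (X ^ 2)) (2 * n) ≤ algebraicClasses A.X n := by
  haveI := zeta12_fact_cmPolyQ hR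
  exact carrier_exists_cmMember_hodgeConjectureFor_of_sqrt R hR
    (roots_real_neg_of_quadratic hR (by norm_num) (by norm_num) (by norm_num)) _ (zeta12_twist_sq hR)
    one_pos _ (zeta12_sqrtNegOne_sq hR) hn δ

end Zeta12

/-! ## §3 `ℚ(√-3,√5)`: `R = S² + 9S + 9` (`η = √-3(1+√5)/2`), biquadratic, `√-3 = -(η³ + 6η)/3` -/

section SqrtNeg3Sqrt5

variable {R : Polynomial ℤ} (hR : R = X ^ 2 + C 9 * X + C 9)
include hR

/-- The `Fact` for `E = ℚ(√-3,√5) = ℚ[T]/(T⁴ + 9T² + 9)` (discriminant `45 = 5·3²`). [folklore] -/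
theorem sqrtNeg3Sqrt5_fact_cmPolyQ : Fact (Irreducible (cmPolyQ R)) :=
  fact_irreducible_cmPolyQ_of_pos hR (by norm_num) (by norm_num)
    (not_sq_of_eq_prime_mul_sq (ℓ := 5) Nat.prime_five (m := 3) (by norm_num) (by norm_num))

/-- In `ℚ(√-3,√5)`: `η' = -(η³ + 9η)/3 = 3η⁻¹` satisfies `η'² + η² + 9 = 0`. [folklore] -/
theorem sqrtNeg3Sqrt5_twist_sq [Fact (Irreducible (cmPolyQ R))] :
    (-(cmRoot R ^ 3 + 9 * cmRoot R) / 3) ^ 2 + cmRoot R ^ 2 + ((9 : ℤ) : cmField R) = 0 := by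
  have ht := cmRoot_quartic R hR
  push_cast at ht ⊢
  linear_combination (cmRoot R ^ 2 / 9 + 1) * ht

/-- In `ℚ(√-3,√5)`: `√-3 = -(η³ + 6η)/3` satisfies `(√-3)² + 3 = 0`. [folklore] -/
theorem sqrtNeg3Sqrt5_sqrtNegThree_sq [Fact (Irreducible (cmPolyQ R))] :
    (-(cmRoot R ^ 3 + 6 * cmRoot R) / 3) ^ 2 + ((3 : ℤ) : cmField R) = 0 := by
  have ht := cmRoot_quartic R hR
  push_cast at ht ⊢
  linear_combination (cmRoot R ^ 2 / 9 + 1 / 3) * ht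

/-- **`ℚ(√-3,√5)/ℚ` is Galois.** [folklore] -/
theorem sqrtNeg3Sqrt5_isGalois [Fact (Irreducible (cmPolyQ R))] : IsGalois ℚ (cmField R) :=
  isGalois_of_sq_add R hR _ (sqrtNeg3Sqrt5_twist_sq hR)

/-- **The rows `W8.ℚ(√-3,√5).δ`: on EVERY row a CM eightfold with HC in the kernel** (`B⁴`, `B ~ C₁²`, `C₁` with CM
by `ℚ(√-3)`; index type of `sqrtNeg3Sqrt5_table`). [cite: Gordon1999HodgeAVSurvey, Thm. 6.4]
[cite: Deligne1982HodgeCycles, §5 (c) pp. 38–39] -/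
theorem sqrtNeg3Sqrt5_carrier_rows_hodgeConjectureFor [Fact (Irreducible (realPolyQ R))] (δ : cmNormResidueGroup R) :
    ∃ (A : AbelianVariety ℂ) (η : A ⟶ A) (h : complexBetti A.X 2),
      A.dim = 8 ∧ IsOfCMType A ∧ IsWeilTypeCM A η R 2 2 ∧ IsPolarizationClass A.dim A.X h ∧ RosatiCompatible A η h ∧
      HasWeilDiscriminantCM A η R 2 2 h δ ∧ HodgeConjectureFor A.dim A.X ∧
      weilClassesField A η (R.comp (X ^ 2)) (2 * 2) ≤ algebraicClasses A.X 2 := by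
  haveI := sqrtNeg3Sqrt5_fact_cmPolyQ hR
  exact carrier_exists_cmEightfold_hodgeConjectureFor_of_sqrt R hR
    (roots_real_neg_of_quadratic hR (by norm_num) (by norm_num) (by norm_num)) _ (sqrtNeg3Sqrt5_twist_sq hR)
    three_pos _ (sqrtNeg3Sqrt5_sqrtNegThree_sq hR) δ

/-- **All ranks: rows `W_{4n}.E.δ`, every `n ≥ 1` (`g = 4, 8, 12, …`), every `δ`** — a CM member of induced type
(from `ℚ(√-3)`) with Weil type of `E`-rank `2n`, polarization class of discriminant `δ`, HC in the kernel, `W_E ⊗ ℂ`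
algebraic. [cite: Gordon1999HodgeAVSurvey, Thm. 6.4] [cite: Deligne1982HodgeCycles, §5 (c) pp. 38–39] -/
theorem sqrtNeg3Sqrt5_carrier_allRanks_hodgeConjectureFor [Fact (Irreducible (realPolyQ R))] {n : ℕ} (hn : 0 < n)
    (δ : cmNormResidueGroup R) :
    ∃ (A : AbelianVariety ℂ) (η : A ⟶ A) (h : complexBetti A.X 2),
      IsOfCMType A ∧ IsWeilTypeCM A η R 2 n ∧ IsPolarizationClass A.dim A.X h ∧ RosatiCompatible A η h ∧
      HasWeilDiscriminantCM A η R 2 n h δ ∧ HodgeConjectureFor A.dim A.X ∧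
      weilClassesField A η (R.comp (X ^ 2)) (2 * n) ≤ algebraicClasses A.X n := by
  haveI := sqrtNeg3Sqrt5_fact_cmPolyQ hR
  exact carrier_exists_cmMember_hodgeConjectureFor_of_sqrt R hR
    (roots_real_neg_of_quadratic hR (by norm_num) (by norm_num) (by norm_num)) _ (sqrtNeg3Sqrt5_twist_sq hR)
    three_pos _ (sqrtNeg3Sqrt5_sqrtNegThree_sq hR) hn δ

end SqrtNeg3Sqrt5

/-! ## §4 `ℚ(i,√5)`: `R = S² + 3S + 1` (`η = i(1+√5)/2`), biquadratic, `i = -η³ - 2η` -/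

section SqrtNeg1Sqrt5

variable {R : Polynomial ℤ} (hR : R = X ^ 2 + C 3 * X + C 1)
include hR

/-- The `Fact` for `E = ℚ(i,√5) = ℚ[T]/(T⁴ + 3T² + 1)` (discriminant `5`). [folklore] -/
theorem sqrtNeg1Sqrt5_fact_cmPolyQ : Fact (Irreducible (cmPolyQ R)) :=
  fact_irreducible_cmPolyQ_of_pos hR (by norm_num) (by norm_num)
    (not_sq_of_eq_prime_mul_sq (ℓ := 5) Nat.prime_five (m := 1) one_ne_zero (by norm_num))

/-- In `ℚ(i,√5)`: `η' = -η³ - 3η = η⁻¹` satisfies `η'² + η² + 3 = 0`. [folklore] -/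
theorem sqrtNeg1Sqrt5_twist_sq [Fact (Irreducible (cmPolyQ R))] :
    (-cmRoot R ^ 3 - 3 * cmRoot R) ^ 2 + cmRoot R ^ 2 + ((3 : ℤ) : cmField R) = 0 := by
  have ht := cmRoot_quartic R hR
  push_cast at ht ⊢
  linear_combination (cmRoot R ^ 2 + 3) * ht

/-- In `ℚ(i,√5)`: `i = -η³ - 2η` satisfies `i² + 1 = 0`. [folklore] -/
theorem sqrtNeg1Sqrt5_sqrtNegOne_sq [Fact (Irreducible (cmPolyQ R))] :
    (-cmRoot R ^ 3 - 2 * cmRoot R) ^ 2 + ((1 : ℤ) : cmField R) = 0 := by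
  have ht := cmRoot_quartic R hR
  push_cast at ht ⊢
  linear_combination (cmRoot R ^ 2 + 1) * ht

/-- **`ℚ(i,√5)/ℚ` is Galois.** [folklore] -/
theorem sqrtNeg1Sqrt5_isGalois [Fact (Irreducible (cmPolyQ R))] : IsGalois ℚ (cmField R) :=
  isGalois_of_sq_add R hR _ (sqrtNeg1Sqrt5_twist_sq hR)

/-- **The rows `W8.ℚ(i,√5).δ`: on EVERY row a CM eightfold with HC in the kernel** (`B⁴`, `B ~ C₁²`, `C₁` with CM by
`ℚ(i)`; index type of `sqrtNeg1Sqrt5_table`). [cite: Gordon1999HodgeAVSurvey, Thm. 6.4]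
[cite: Deligne1982HodgeCycles, §5 (c) pp. 38–39] -/
theorem sqrtNeg1Sqrt5_carrier_rows_hodgeConjectureFor [Fact (Irreducible (realPolyQ R))] (δ : cmNormResidueGroup R) :
    ∃ (A : AbelianVariety ℂ) (η : A ⟶ A) (h : complexBetti A.X 2),
      A.dim = 8 ∧ IsOfCMType A ∧ IsWeilTypeCM A η R 2 2 ∧ IsPolarizationClass A.dim A.X h ∧ RosatiCompatible A η h ∧
      HasWeilDiscriminantCM A η R 2 2 h δ ∧ HodgeConjectureFor A.dim A.X ∧
      weilClassesField A η (R.comp (X ^ 2)) (2 * 2) ≤ algebraicClasses A.X 2 := by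
  haveI := sqrtNeg1Sqrt5_fact_cmPolyQ hR
  exact carrier_exists_cmEightfold_hodgeConjectureFor_of_sqrt R hR
    (roots_real_neg_of_quadratic hR (by norm_num) (by norm_num) (by norm_num)) _ (sqrtNeg1Sqrt5_twist_sq hR)
    one_pos _ (sqrtNeg1Sqrt5_sqrtNegOne_sq hR) δ

/-- **All ranks: rows `W_{4n}.E.δ`, every `n ≥ 1` (`g = 4, 8, 12, …`), every `δ`** — a CM member of induced type
(from `ℚ(i)`) with Weil type of `E`-rank `2n`, polarization class of discriminant `δ`, HC in the kernel, `W_E ⊗ ℂ`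
algebraic. [cite: Gordon1999HodgeAVSurvey, Thm. 6.4] [cite: Deligne1982HodgeCycles, §5 (c) pp. 38–39] -/
theorem sqrtNeg1Sqrt5_carrier_allRanks_hodgeConjectureFor [Fact (Irreducible (realPolyQ R))] {n : ℕ} (hn : 0 < n)
    (δ : cmNormResidueGroup R) :
    ∃ (A : AbelianVariety ℂ) (η : A ⟶ A) (h : complexBetti A.X 2),
      IsOfCMType A ∧ IsWeilTypeCM A η R 2 n ∧ IsPolarizationClass A.dim A.X h ∧ RosatiCompatible A η h ∧
      HasWeilDiscriminantCM A η R 2 n h δ ∧ HodgeConjectureFor A.dim A.X ∧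
      weilClassesField A η (R.comp (X ^ 2)) (2 * n) ≤ algebraicClasses A.X n := by
  haveI := sqrtNeg1Sqrt5_fact_cmPolyQ hR
  exact carrier_exists_cmMember_hodgeConjectureFor_of_sqrt R hR
    (roots_real_neg_of_quadratic hR (by norm_num) (by norm_num) (by norm_num)) _ (sqrtNeg1Sqrt5_twist_sq hR)
    one_pos _ (sqrtNeg1Sqrt5_sqrtNegOne_sq hR) hn δ

end SqrtNeg1Sqrt5

end Summit.HodgeConjecture.HodgeConjecture.Ring2.WeilCoverageCM

end
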